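import Literature.Barriers.FinalStateConjecture.TrappingDerivativeLossEnergy
import Literature.Barriers.FinalStateConjecture.TrappingDerivativeLossGeodesicBeams
import HarnessLib

/-!
# Sbierski's Kerr trapping theorem from the two canonical named facts, the trapped photon orbit proved
(fourth companion file of `Literature/Barriers/FinalStateConjecture/TrappingDerivativeLoss.lean`;
family `gr`, summit `FinalStateConjecture`; namespace `Literature.Barriers.FinalStateConjecture`)

`TrappingDerivativeLoss.lean` vendors Sbierski's theorem that trapping on the Kerr exterior
`0 ≤ a ≤ M`, `M > 0` rules out local energy decay in terms of the first-order energy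
(`SbierskiKerrTrappingLED`, the print-literal Anal. PDE 8 (2015), Thm. 7.4;
`SbierskiTrappingObstruction`, its data-localised reading). Its printed proof "invokes Theorem 5.5",
whose proof draws its contradiction from the localised solutions of Thm. 5.1, and Thm. 5.1 in turn
"follows easily from Theorem 2.1 [the Cauchy problem with the energy estimate, given the Gaussian
beams of §3], Theorem 4.1 [the characterisation of the energy of Gaussian beams] […] and the
triangle inequality for the square root of the `N`-energy" (proof of Thm. 5.1), applied along the
trapped null geodesics of §7A. The companion files machine-check every soft step of this chain:

* Thm. 5.5's argument: `SbierskiTrappingObstruction.of_localisedSolutions`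
  (`TrappingDerivativeLossProofs.lean`);
* Thm. 2.1's approximation argument and the energy estimate (Grönwall on the surgered Kerr–Schild
  background): `SbierskiKerrLocalisedSolutions.of_waveCauchyProblem_of_trappedGeodesicBeams`,
  `kerr_localEnergyEstimate_of_waveCauchyProblem` (`TrappingDerivativeLossEnergy.lean`);
* the passage from Sbierski's `N`-energy to the coordinate energies, the time cut-off and the
  support bookkeeping: `SbierskiKerrGaussianBeams.of_trappedGeodesicBeams` (`…Beams.lean`) and,
  with the support fixed before the accuracy,
  `SbierskiKerrTrappedGeodesicBeams.gaussianBeams_uniformSupport`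
  (`TrappingDerivativeLossEnergy.lean`);
* §7A's trapped null geodesic with `N`-energy in `[e₁, e₂] ⊂ (0, ∞)`:
  `Sbierski2015_kerr_trappedNullGeodesic_holds` (`Literature/Geometry/Lorentzian/KerrPhotonOrbit.lean`,
  the retrograde equatorial circular photon orbit), fed into the beams along a *given* null geodesic
  by `SbierskiKerrTrappedGeodesicBeams.of_nullGeodesicBeams'` (`…GeodesicBeams.lean`).

What is left are the paper's two hard inputs, each a theory absent from Mathlib and `Literature/`,
vendored once each as the **canonical named facts**

* `KerrSchild.waveCauchyProblem` (`Literature/Geometry/Lorentzian/KerrSchildWaveCauchyProblem.lean`: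
  the smooth Cauchy problem with domain of dependence for `□_g` on generalised Kerr–Schild
  backgrounds over `ℝ⁴`; Bär–Ginoux–Pfäffle 2007, Thm. 3.2.11 with Choquet-Bruhat–Cotsakis 2002,
  Thm. 2.1 — shared with the Aretakis barrier), and
* `KerrNullGeodesicGaussianBeams` (`…GeodesicBeams.lean`: Sbierski's Part I, §3–§4 — Gaussian beams
  with the geometric characterisation of their energy — along an arbitrary future-directed null
  geodesic of the Kerr exterior).

This file records the end of the chain: **the barrier, in both readings, and the localised
solutions follow from these two facts alone** (`SbierskiKerrTrappingLED.of_waveCauchyProblem_of_nullGeodesicBeams`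
and its siblings, one-line compositions of the theorems above), so that the trust base of
`SbierskiTrappingObstruction` / `SbierskiKerrTrappingLED` is exactly
{`KerrSchild.waveCauchyProblem`, `KerrNullGeodesicGaussianBeams`}.

**History (D-0026 review of a decomposition child).** The first version of this file (p22620)
proved Thm. 7.4 from the named fact `Sbierski2015_kerr_beamSolutions` of
`Literature/Geometry/Lorentzian/KerrGaussianBeams.lean` — Thm. 5.1 itself, specialised to the Kerr
exterior along an arbitrary null geodesic, in Sbierski's own `N`-energy — by Thm. 5.5's argument in
that currency (`SbierskiKerrTrappingLED.of_beams`). By the proof of Thm. 5.1 quoted above that fact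
is the conjunction, up to Thm. 2.1's argument, of the two canonical facts, both of which were
vendored separately in the meantime; as a standalone fact it is theory-sized twice over and, as a
leaf of the trust base, a coarser duplicate of the pair. It was therefore merged back (the `def`
retired from `KerrGaussianBeams.lean`, which keeps the §7A geodesic fact and the vocabulary
`Kerr.setLeafFlux`, `Kerr.timeSection`), and with it the `N`-energy rendering of Thm. 5.5's
argument, whose coordinate-energy twin `SbierskiTrappingObstruction.of_localisedSolutions` is the
one on the live path. The comparability lemma `setLeafFlux_le_localSliceEnergy_of_pos`
(`E^V_{τ, A} ≤ 15 · localSliceEnergy` for `A` inside the coordinate ball) is kept.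

## References

* J. Sbierski, Anal. PDE 8 (2015) 1379–1420 (arXiv:1311.2477): Thm. 2.1 and its proof, Thm. 4.1,
  Thm. 5.1 and its proof (pp. 1396–1397; arXiv Thm. 2.44, p. 21–22 of the 46-page version),
  Thm. 5.5 and its proof (p. 1397), §7A (pp. 1412–1414), Thm. 7.4 (pp. 1414–1415)
  (key `Sbierski2015`).
* C. Bär, N. Ginoux, F. Pfäffle, *Wave equations on Lorentzian manifolds and quantization*, EMS
  2007, Thm. 3.2.11 (key `BarGinouxPfaffle2007`).
* M. Dafermos, I. Rodnianski, Y. Shlapentokh-Rothman, Ann. of Math. 183 (2016), §3.1 (the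
  comparability of `J^N`-fluxes with coordinate energies)
  (key `DafermosRodnianskiShlapentokhrothman2014`).
-/

noncomputable section

open Set Filter MeasureTheory
open scoped Manifold ContDiff ENNReal Topology

namespace Literature.Barriers.FinalStateConjecture

open Literature.Geometry.Lorentzian

/-! ### The `V`-energy in a volume against the local coordinate energy -/

/-- **The `V`-energy in a volume inside the coordinate ball is at most `15×` the local coordinate
energy**, on the exterior for `0 < M` and every `a`: `E^V_{τ, A}(ψ) ≤ 15 · localSliceEnergy ψ τ R`
for `A ⊆ {‖y‖ ≤ R}` (integrated form of `leafFluxDensity_le_indicator_coordEnergyDensity_of_pos`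
of `TrappingDerivativeLossBeams.lean`; DRSR arXiv:1402.7034, §3.1, comparability display
following (23), for `Σ_τ = {t* = τ}`, `N = V`).
[cite: DafermosRodnianskiShlapentokhrothman2014, §3.1 display following (23)] -/
theorem setLeafFlux_le_localSliceEnergy_of_pos [Kerr.Facts] {M a : ℝ} (hM : 0 < M)
    (ψ : Kerr.region a (Kerr.rPlus M a) → ℝ) (τ : ℝ) {A : Set E3} {R : ℝ}
    (hA : A ⊆ Metric.closedBall 0 R) :
    Kerr.setLeafFlux M a ψ τ A ≤ 15 * localSliceEnergy (Kerr.region a (Kerr.rPlus M a)) ψ τ R := by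
  refine (Kerr.setLeafFlux_mono M a ψ τ hA).trans ?_
  rw [Kerr.setLeafFlux, localSliceEnergy,
    ← lintegral_const_mul' _ _ (ENNReal.ofNat_ne_top (n := 15))]
  exact lintegral_mono fun y ↦ leafFluxDensity_le_indicator_coordEnergyDensity_of_pos hM ψ τ y

/-! ### The localised solutions and the barrier from the two canonical named facts -/

/-- **Sbierski's localised solutions along the trapped null geodesics of Kerr (Thm. 5.1 with §7A,
rendered: `SbierskiKerrLocalisedSolutions`) from the two canonical named facts** — the Cauchy
problem on generalised Kerr–Schild backgrounds (`KerrSchild.waveCauchyProblem`) and the Gaussian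
beams along a given null geodesic of the Kerr exterior (`KerrNullGeodesicGaussianBeams`) — the
trapped geodesic of §7A being the theorem `Sbierski2015_kerr_trappedNullGeodesic_holds`. This is the
printed proof of Thm. 5.1 ("follows easily from Theorem 2.1, Theorem 4.1 […]") with §7A:
`SbierskiKerrLocalisedSolutions.of_waveCauchyProblem_of_trappedGeodesicBeams` after
`SbierskiKerrTrappedGeodesicBeams.of_nullGeodesicBeams'`.
[cite: Sbierski2015, Thm. 5.1 (proof) with §7A and Thm. 4.1] -/
theorem SbierskiKerrLocalisedSolutions.of_waveCauchyProblem_of_nullGeodesicBeams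
    (hA : KerrSchild.waveCauchyProblem) (hB : KerrNullGeodesicGaussianBeams) :
    SbierskiKerrLocalisedSolutions :=
  SbierskiKerrLocalisedSolutions.of_waveCauchyProblem_of_trappedGeodesicBeams hA
    (SbierskiKerrTrappedGeodesicBeams.of_nullGeodesicBeams' hB)

/-- **The data-localised trapping obstruction `SbierskiTrappingObstruction` from the two canonical
named facts** `KerrSchild.waveCauchyProblem` and `KerrNullGeodesicGaussianBeams` (Thm. 7.4 via the
LED criterion Thm. 5.5, `SbierskiTrappingObstruction.of_localisedSolutions`, and Thm. 5.1 as above).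
Its trust base is thereby exactly this pair. [cite: Sbierski2015, Thm. 7.4 with Thm. 5.5 and Thm. 5.1] -/
theorem SbierskiTrappingObstruction.of_waveCauchyProblem_of_nullGeodesicBeams
    (hA : KerrSchild.waveCauchyProblem) (hB : KerrNullGeodesicGaussianBeams) :
    SbierskiTrappingObstruction :=
  SbierskiTrappingObstruction.of_waveCauchyProblem_of_trappedGeodesicBeams hA
    (SbierskiKerrTrappedGeodesicBeams.of_nullGeodesicBeams' hB)

/-- **Sbierski's Kerr trapping theorem (print-literal Thm. 7.4, `SbierskiKerrTrappingLED`) from the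
two canonical named facts** `KerrSchild.waveCauchyProblem` and `KerrNullGeodesicGaussianBeams`, via
the data-localised obstruction and `SbierskiTrappingObstruction.literal`.
[cite: Sbierski2015, Thm. 7.4 with Thm. 5.5, Thm. 5.1 and §7A] -/
theorem SbierskiKerrTrappingLED.of_waveCauchyProblem_of_nullGeodesicBeams
    (hA : KerrSchild.waveCauchyProblem) (hB : KerrNullGeodesicGaussianBeams) :
    SbierskiKerrTrappingLED :=
  SbierskiTrappingObstruction.literal
    (SbierskiTrappingObstruction.of_waveCauchyProblem_of_nullGeodesicBeams hA hB)

end Literature.Barriers.FinalStateConjecture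

end
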